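import Literature.AlgebraicGeometry.HodgeTheory.DirectImageTransport
import Literature.AlgebraicGeometry.HodgeTheory.RealStructureSingular
import HarnessLib

/-!
# Coefficients of the restrictions of a global class in a flat frame are locally constant

Layer `Literature/AlgebraicGeometry/HodgeTheory`, namespace `Literature.AlgebraicGeometry.HodgeTheory`.  THEOREMS ONLY (no
definition, no named fact, no instance).  Generic bookkeeping over the tree's transport in `Rᵏ π_* ℂ|_U`
(`DirectImageTransport`: `transportFun`, Voisin I §9.2.1) for a family `π : 𝒳 ⟶ S` of complex schemes cohomologically locally
trivial over `U ⊆ S(ℂ)` (`IsCohomologicallyLocallyTrivialOn`):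

* `coeff_eq_of_transportFun_eq_sum` — if a fibre class `a` over `s` is carried by transport along `p` to `b` over `t`, and both
  are expanded in frames `β s`, `β t` which transport carries to each other (`β t` linearly independent), the coefficient
  vectors agree («flat sections of a local system have constant coordinates in a flat frame»);
* `coeff_eq_of_map_fiberι_eq_sum` — the case `a = C|_{X_s}`, `b = C|_{X_t}` for a GLOBAL class `C ∈ Hᵏ(𝒳(ℂ); ℂ)`
  (★ `transportFun_map_fiberι`: restrictions of global classes are flat, Voisin II §3.1.2);
* `transportFun_cupProduct_of_eq` — cup products of flat degree-one frames are flat degree-two frames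
  (★ `transportFun_cupProduct`);
* **`cupCoeff_eq_of_map_fiberι_eq_sum`** / `…_of_isPathConnected` / `intCupCoeff_eq_…` — the form consumed by the cell
  `hodgecm-mathlib` (U)-lane ((N3-core) «the Gram matrix of a global class is flat in a flat integral frame»): for a RATIONAL
  degree-one frame `γ x a ∈ H¹(X_x(ℂ); ℚ)` whose complexifications are carried to each other by transport along every homotopy class
  of paths in `U` (clause (iii) of the cell's `IsFlatIntegralFrame`, taken verbatim as a hypothesis) and a global class `C ∈ H²(𝒳(ℂ); ℂ)`
  whose restriction to each fibre is `Σ_j G_x(j) · γ_x(e_j.1) ∪ γ_x(e_j.2)` over a linearly independent cup family, the coefficient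
  vector `G_x` (complex, or INTEGER) is the same at any two points joined in `U` — constant on `U` when `U` is path connected.

Nothing here uses a Chern class: the input is any global class.  Cell pointer: node U-e, road (T-top), leaf (T2) item (L6)
(B-p05 (g13) 14:50:57Z / B-plan2 (g11) 14:52:27Z); HC_CM is proved only modulo the 7 printed citations until rung 0 closes, and
this file discharges none of them.

## References
* [VoisinHodgeI2002] C. Voisin, *Hodge Theory and Complex Algebraic Geometry I*, CUP 2002, §9.2.1 (local systems and flat sections).
* [VoisinHodgeII2003] C. Voisin, *Hodge Theory and Complex Algebraic Geometry II*, CUP 2003, §3.1.2 (restrictions of global classes,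
  compatibility of transport with the cup product).
* [LangeBirkenhake1992] H. Lange, Ch. Birkenhake, *Complex Abelian Varieties*, Springer 1992, Ch. 8 §8.1 (families of marked polarised
  abelian varieties: the type of the polarisation is locally constant).
-/

set_option autoImplicit false

noncomputable section

open CategoryTheory AlgebraicGeometry
open Literature.AlgebraicTopology.SingularHomology

namespace Literature.AlgebraicGeometry.HodgeTheory

variable {𝒳 S : Motives.SchemeOver ℂ} (π : 𝒳 ⟶ S) (k : ℕ) {U : Set (Motives.ComplexPoints S)}
  (hU : IsCohomologicallyLocallyTrivialOn π U)

/-! ### §1 Flat classes have constant coordinates in a flat frame -/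

/-- Transport is a finite sum of its values («`ℂ`-linearity», ★ `transportLinear`). [cite: VoisinHodgeI2002, §9.2.1] -/
theorem transportFun_sum_smul {J : Type} [Fintype J] {s t : U} (p : Path.Homotopic.Quotient s t) (G : J → ℂ)
    (β : J → complexBetti (Motives.fiberOver π s.1) k) :
    transportFun π k hU p (∑ j, G j • β j) = ∑ j, G j • transportFun π k hU p (β j) := by
  change transportLinear π k hU p (∑ j, G j • β j) = ∑ j, G j • transportLinear π k hU p (β j)
  rw [map_sum]
  exact Finset.sum_congr rfl fun j _ ↦ map_smul _ _ _

/-- **Flat sections have constant coordinates in a flat frame.**  If transport along `p` carries `a` to `b` and the frame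
`β s` to the frame `β t`, the latter linearly independent, then the expansions `a = Σ G_j β_s(j)`, `b = Σ H_j β_t(j)` have the same
coefficients. [cite: VoisinHodgeI2002, §9.2.1] -/
theorem coeff_eq_of_transportFun_eq_sum {J : Type} [Fintype J] {s t : U} (p : Path.Homotopic.Quotient s t)
    (β : ∀ x : U, J → complexBetti (Motives.fiberOver π x.1) k)
    (hβ : ∀ j, transportFun π k hU p (β s j) = β t j) (hind : LinearIndependent ℂ (β t))
    {a : complexBetti (Motives.fiberOver π s.1) k} {b : complexBetti (Motives.fiberOver π t.1) k}
    (hab : transportFun π k hU p a = b) {G H : J → ℂ} (ha : a = ∑ j, G j • β s j) (hb : b = ∑ j, H j • β t j) :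
    G = H := by
  subst ha
  rw [transportFun_sum_smul, hb] at hab
  simp only [hβ] at hab
  have h0 : ∑ j, (G j - H j) • β t j = 0 := by
    simp only [sub_smul, Finset.sum_sub_distrib, hab, sub_self]
  funext j
  exact sub_eq_zero.1 (Fintype.linearIndependent_iff.1 hind (fun j ↦ G j - H j) h0 j)

/-! ### §2 Restrictions of a global class -/

/-- **The coordinates of the restrictions `C|_{X_x}` of a GLOBAL class `C ∈ Hᵏ(𝒳(ℂ); ℂ)` in a flat frame are the same at the two
ends of any path in `U`** (★ `transportFun_map_fiberι`: restrictions of global classes are flat). [cite: VoisinHodgeII2003, §3.1.2] -/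
theorem coeff_eq_of_map_fiberι_eq_sum {J : Type} [Fintype J] {s t : U} (p : Path.Homotopic.Quotient s t)
    (β : ∀ x : U, J → complexBetti (Motives.fiberOver π x.1) k)
    (hβ : ∀ j, transportFun π k hU p (β s j) = β t j) (hind : LinearIndependent ℂ (β t))
    (C : complexBetti 𝒳 k) (G : U → J → ℂ)
    (hC : ∀ x : U, complexBetti.map (Motives.fiberι π x.1) k C = ∑ j, G x j • β x j) : G s = G t :=
  coeff_eq_of_transportFun_eq_sum π k hU p β hβ hind (transportFun_map_fiberι π k hU p C) (hC s) (hC t)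

/-! ### §3 Cup products of flat degree-one frames -/

/-- Cup products of classes carried to each other by transport are carried to each other (★ `transportFun_cupProduct`).
[cite: VoisinHodgeII2003, §3.1.2] -/
theorem transportFun_cupProduct_of_eq {p₁ p₂ r : ℕ} (h : p₁ + p₂ = r) {s t : U} (p : Path.Homotopic.Quotient s t)
    {a : complexBetti (Motives.fiberOver π s.1) p₁} {b : complexBetti (Motives.fiberOver π s.1) p₂}
    {a' : complexBetti (Motives.fiberOver π t.1) p₁} {b' : complexBetti (Motives.fiberOver π t.1) p₂}
    (ha : transportFun π p₁ hU p a = a') (hb : transportFun π p₂ hU p b = b') :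
    transportFun π r hU p (cupProduct h a b) = cupProduct h a' b' := by
  rw [transportFun_cupProduct π hU h p a b, ha, hb]

/-! ### §4 The Gram-matrix form: a global degree-two class in the cup frame of a flat rational degree-one frame -/

/-- **(N3-core) bookkeeping — the coefficient matrix of a global class `C ∈ H²(𝒳(ℂ); ℂ)` in the cup frame `γ_x(a) ∪ γ_x(b)` of a
FLAT rational degree-one frame is the same at any two points joined in `U`.**  Hypotheses: the flatness clause (iii) of the cell's
`IsFlatIntegralFrame` verbatim (`γ x a ⊗ 1` carried to `γ x′ a ⊗ 1` along every homotopy class of paths in `U`), the expansion of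
`C|_{X_x}` over a cup family indexed by `e : J → ι × ι` with complex coefficients `G x`, and linear independence of that family.
[cite: VoisinHodgeII2003, §3.1.2] [cite: LangeBirkenhake1992, Ch. 8 §8.1] -/
theorem cupCoeff_eq_of_map_fiberι_eq_sum {ι J : Type} [Fintype J] (e : J → ι × ι) (h : 1 + 1 = 2)
    (γ : ∀ x : U, ι → singularCohomology ℚ ℚ (Motives.ComplexPoints (Motives.fiberOver π x.1)) 1)
    (hγ : ∀ (x x' : U) (p : Path.Homotopic.Quotient x x') (a : ι),
      transportFun π 1 hU p (ofRatClass _ 1 (γ x a)) = ofRatClass _ 1 (γ x' a))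
    (C : complexBetti 𝒳 2) (G : U → J → ℂ)
    (hC : ∀ x : U, complexBetti.map (Motives.fiberι π x.1) 2 C =
      ∑ j, G x j • cupProduct h (ofRatClass _ 1 (γ x (e j).1)) (ofRatClass _ 1 (γ x (e j).2)))
    (hind : ∀ x : U, LinearIndependent ℂ fun j ↦ cupProduct h (ofRatClass _ 1 (γ x (e j).1)) (ofRatClass _ 1 (γ x (e j).2)))
    {s t : U} (p : Path.Homotopic.Quotient s t) : G s = G t :=
  coeff_eq_of_map_fiberι_eq_sum π 2 hU p
    (fun x j ↦ cupProduct h (ofRatClass _ 1 (γ x (e j).1)) (ofRatClass _ 1 (γ x (e j).2)))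
    (fun j ↦ transportFun_cupProduct_of_eq π hU h p (hγ s t p (e j).1) (hγ s t p (e j).2)) (hind t) C G hC

/-- **Integer form**: with INTEGER coefficient matrices `G x` (the case of an integral class in the cup frame of an integral
frame) the matrix is the same at any two points joined in `U`. [cite: LangeBirkenhake1992, Ch. 8 §8.1] -/
theorem intCupCoeff_eq_of_map_fiberι_eq_sum {ι J : Type} [Fintype J] (e : J → ι × ι) (h : 1 + 1 = 2)
    (γ : ∀ x : U, ι → singularCohomology ℚ ℚ (Motives.ComplexPoints (Motives.fiberOver π x.1)) 1)
    (hγ : ∀ (x x' : U) (p : Path.Homotopic.Quotient x x') (a : ι),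
      transportFun π 1 hU p (ofRatClass _ 1 (γ x a)) = ofRatClass _ 1 (γ x' a))
    (C : complexBetti 𝒳 2) (G : U → J → ℤ)
    (hC : ∀ x : U, complexBetti.map (Motives.fiberι π x.1) 2 C =
      ∑ j, ((G x j : ℤ) : ℂ) • cupProduct h (ofRatClass _ 1 (γ x (e j).1)) (ofRatClass _ 1 (γ x (e j).2)))
    (hind : ∀ x : U, LinearIndependent ℂ fun j ↦ cupProduct h (ofRatClass _ 1 (γ x (e j).1)) (ofRatClass _ 1 (γ x (e j).2)))
    {s t : U} (p : Path.Homotopic.Quotient s t) : G s = G t := by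
  have hct := cupCoeff_eq_of_map_fiberι_eq_sum π hU e h γ hγ C (fun x j ↦ ((G x j : ℤ) : ℂ)) hC hind p
  funext j
  exact Int.cast_injective (congrFun hct j)

/-- **Path-connected form**: over a path-connected `U` the coefficient matrix is CONSTANT. [cite: VoisinHodgeI2002, §9.2.1]
[cite: LangeBirkenhake1992, Ch. 8 §8.1] -/
theorem cupCoeff_eq_of_map_fiberι_eq_sum_of_isPathConnected (hW : IsPathConnected U) {ι J : Type} [Fintype J]
    (e : J → ι × ι) (h : 1 + 1 = 2)
    (γ : ∀ x : U, ι → singularCohomology ℚ ℚ (Motives.ComplexPoints (Motives.fiberOver π x.1)) 1)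
    (hγ : ∀ (x x' : U) (p : Path.Homotopic.Quotient x x') (a : ι),
      transportFun π 1 hU p (ofRatClass _ 1 (γ x a)) = ofRatClass _ 1 (γ x' a))
    (C : complexBetti 𝒳 2) (G : U → J → ℂ)
    (hC : ∀ x : U, complexBetti.map (Motives.fiberι π x.1) 2 C =
      ∑ j, G x j • cupProduct h (ofRatClass _ 1 (γ x (e j).1)) (ofRatClass _ 1 (γ x (e j).2)))
    (hind : ∀ x : U, LinearIndependent ℂ fun j ↦ cupProduct h (ofRatClass _ 1 (γ x (e j).1)) (ofRatClass _ 1 (γ x (e j).2)))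
    (s t : U) : G s = G t := by
  obtain ⟨p⟩ := (hW.joinedIn s.1 s.2 t.1 t.2).joined_subtype
  exact cupCoeff_eq_of_map_fiberι_eq_sum π hU e h γ hγ C G hC hind ⟦p⟧

/-- **Path-connected integer form.** [cite: LangeBirkenhake1992, Ch. 8 §8.1] -/
theorem intCupCoeff_eq_of_map_fiberι_eq_sum_of_isPathConnected (hW : IsPathConnected U) {ι J : Type} [Fintype J]
    (e : J → ι × ι) (h : 1 + 1 = 2)
    (γ : ∀ x : U, ι → singularCohomology ℚ ℚ (Motives.ComplexPoints (Motives.fiberOver π x.1)) 1)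
    (hγ : ∀ (x x' : U) (p : Path.Homotopic.Quotient x x') (a : ι),
      transportFun π 1 hU p (ofRatClass _ 1 (γ x a)) = ofRatClass _ 1 (γ x' a))
    (C : complexBetti 𝒳 2) (G : U → J → ℤ)
    (hC : ∀ x : U, complexBetti.map (Motives.fiberι π x.1) 2 C =
      ∑ j, ((G x j : ℤ) : ℂ) • cupProduct h (ofRatClass _ 1 (γ x (e j).1)) (ofRatClass _ 1 (γ x (e j).2)))
    (hind : ∀ x : U, LinearIndependent ℂ fun j ↦ cupProduct h (ofRatClass _ 1 (γ x (e j).1)) (ofRatClass _ 1 (γ x (e j).2)))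
    (s t : U) : G s = G t := by
  obtain ⟨p⟩ := (hW.joinedIn s.1 s.2 t.1 t.2).joined_subtype
  exact intCupCoeff_eq_of_map_fiberι_eq_sum π hU e h γ hγ C G hC hind ⟦p⟧

end Literature.AlgebraicGeometry.HodgeTheory

end
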